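import Summits.BirchSwinnertonDyer.BirchSwinnertonDyer.Theses.PrintX10b
import Summits.BirchSwinnertonDyer.BirchSwinnertonDyer.Theorems.PrintX10bUpperLinkRoad
import HarnessLib

/-!
# `AssemblyPinnedTwinsX10b` (stmt-BirchSwinnertonDyer-26625, route PrintX10b rev 20, rank 1) HOLDS:
# the Cha-free, J₃-free pinned assembly of the X10b leaf — TURNKEY T-H landed

HONEST FRAMING (cell `run/shared/lean/pub/bsd-print-x9/`, D-0154 KEY row 10, seat `bsd-line-x10b-p1-w2`
gen 2 = «x10b-p1 successor» of plan g9 PROGRESS 3 (e); lineage: crux stmt-BirchSwinnertonDyer-23055). This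
file proves the route decl `PrintX10b.AssemblyPinnedTwinsX10b` BY NAME and OUTRIGHT (no hypothesis, no named
fact, no `sorry`): it is an IMPLICATION between route items —
`HowardContainmentAnyClassNumberX10bPinned → TwoSidedLinkAnyClassNumberX10bPinned → HeegnerPrintFactsX10b →
AnalyticMuZeroX10b → PrintFactsX10b → X10.BSDpOnClassX10b` — so closing it books NO mathematics beyond the
composition: the leaf `X10.BSDpOnClassX10b` stays conditional on A₃^pin (beyond print in its μ-part at
`3 ∣ h_K`, deciding crux stmt-26623), on B₃^pin (print modulo the bundle door stmt-26624), on
`AnalyticMuZeroX10b` and on the two print bundles. «beyond-print theorem»: NO. BSD is not proved by any of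
this; no summit statement is proved by this seat.

PROOF (plan g9 x10b Sketch `assemblyPinnedTwinsX10b_turnkey`, verbatim up to names): the upper-link road
`X10.bsdpOnClassX10b_of_upperLink_of_printFacts` (this lineage, p608951: p4's proved assembly with the J₃ crux
replaced by the one-sided link U₃; Cha 2005 Rmk. 25, Darmon's conductor-1 datum and the derived-Heegner-point
layer unused) reduces the leaf to U₃ on every X10b Heegner frame; at a frame, A₃^pin (instantiated with
`d_K ≠ −4`, which follows from `Odd d_K`) gives the TIED containment `∃ jbar D F X, F.Dt = Dt ∧ I(ℋ_F)² ≤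
char(X_tors)`, B₃^pin turns it into the two-sided identity `IMCWaldspurgerOnTreeGoodAt`, and its `≤` half is U₃.

References: [JetchevSkinnerWan2017] Thm. 3.3.1, §7.4.1; [Castella2018] Thm. 2.3, §5 (eq:IMC+BDP);
[YanZhu2024MainConjNonCM] Thm. 5.7 (1), Thm. 5.9; [CastellaGrossiLeeSkinner2022] Thm. 4.1.1, Thm. 5.1.3;
[MastellaZerman2026] Cor. 4.6; route file `Theses/PrintX10b.lean` rev 20 (items 26621–26625);
`Theorems/PrintX10bUpperLinkRoad.lean` (p608951).
-/

set_option autoImplicit false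
set_option linter.dupNamespace false

noncomputable section

open scoped Classical

namespace Summit.BirchSwinnertonDyer.BirchSwinnertonDyer.Theorems.PrintX10bAssemblyPinnedTwinsX10b

open Summit.BirchSwinnertonDyer.BirchSwinnertonDyer.Theses.PrintX10b

/-- **`AssemblyPinnedTwinsX10b` holds** (stmt-BirchSwinnertonDyer-26625; TURNKEY T-H of PrintX10b rev 20): the
pinned twins A₃^pin ∧ B₃^pin give the one-sided link U₃ on every X10b Heegner frame (A₃^pin at the frame —
`d_K ≠ −4` from `Odd d_K` —, B₃^pin fed with the tied containment, `≤` half of the resulting identity), and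
the upper-link road `X10.bsdpOnClassX10b_of_upperLink_of_printFacts` (p608951; NO J₃, NO Cha Rmk. 25) gives
the leaf from U₃, `AnalyticMuZeroX10b` and the two print bundles.
[cite: JetchevSkinnerWan2017, Thm. 3.3.1 and §7.4.1 (arXiv:1512.06894 p. 30) (the road's rank-one descent)]
[cite: Castella2018, Thm. 2.3 and §5 (eq:IMC+BDP) (arXiv:1704.06608 pp. 5, 12) (shape of U₃ and of the identity)]
[cite: Cha2005, Rmk. 25 (p. 175) (NOT used — the point of the pinned road)] -/
theorem assemblyPinnedTwinsX10b_proof : AssemblyPinnedTwinsX10b := by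
  unfold AssemblyPinnedTwinsX10b
  intro hA3 hB3 hHP hA hP
  refine Summit.BirchSwinnertonDyer.Rank1Residual.X10.bsdpOnClassX10b_of_upperLink_of_printFacts ?_ hA hHP hP
  intro W _ _ p _ _ K _ _ hX hns hcm hK hodd h3 hHN hHp hirrK ι κ hκ γ _ Dt hc H ιC P hPt hrk hfinp hPinf
  have h4 : NumberField.discr K ≠ -4 := by
    rintro h
    rw [h] at hodd
    exact absurd hodd (by decide)
  have hHow := hA3 W p K hX hns hcm hK h3 h4 hHN hHp κ hκ γ Fact.out Dt H ιC hc
  obtain ⟨n, hn, heq⟩ :=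
    hB3 W p K hX hns hcm hK hodd h3 hHN hHp hirrK ι κ hκ γ Dt hc H ιC P hPt hrk hfinp hPinf hHow
  exact ⟨n, hn, le_of_eq heq⟩

end Summit.BirchSwinnertonDyer.BirchSwinnertonDyer.Theorems.PrintX10bAssemblyPinnedTwinsX10b

end
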